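import Summits.RiemannHypothesis.RiemannHypothesis.Theses.SpectralTrace
import Summits.RiemannHypothesis.RiemannHypothesis.Theorems.WindowTracePrime2.Negative.FiniteFamilies
import Summits.RiemannHypothesis.RiemannHypothesis.Theorems.WindowTracePrime2.Negative.LoadBearing
import Summits.RiemannHypothesis.RiemannHypothesis.Theorems.WindowTracePrime2.Negative.Poisson
import Summits.RiemannHypothesis.RiemannHypothesis.Theorems.WindowTracePrime2.Negative.BumpPositivity
import Summits.RiemannHypothesis.RiemannHypothesis.Theorems.WindowTracePrime2.Negative.Progressions
import Summits.RiemannHypothesis.RiemannHypothesis.Theorems.WindowTracePrime2.Negative.Modulation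

/-!
# Line `anchor-float` for the crux `WindowTracePrime2` (stmt-RiemannHypothesis-11196)

Skeleton (crux-plan, round 1). Idea card `Cruxes/WindowTracePrime2/Ideas/anchor-float.md` (ideator 2),
restated along the r1 triage panel (TRIAGE-r1-1 §anchor-float "repair: FZC‴", TRIAGE-r1-3 §anchor-float
"PASS after FZC → FZC‴; state ResidualExtend(H) with its support gap").

THE LINE. A witness of `Trace(log 3)` is ANCHOR ∪ FLOAT. The crux quantifies `∃ γ`, so the bottom of the
spectrum — where the window over-determines every witness (BarrierNotes B8/BN5: the lowest atoms are pinned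
to the zeta ordinates to `±0.05`; no slack below `2π·3² ≈ 57`) — is IMPORTED as finitely many real unit atoms
`γ₀ : Fin m → ℝ` (intended: the certified zeta ordinates `|γ| ≤ H`, `H ≤ 3·10¹²`,
`Literature.NumberTheory.LFunctions.platt_trudgian_numerical_rh`), and only the residual
`R_H(g) = W(g) − Σ_j ĝ(½ + iγ₀ⱼ)` has to be synthesised, in the FREE ZONE `|t| ≥ H` where every obstruction
has slack. The line splits the crux into exactly two halves of different nature plus two classical engines:

* `stub_residualExtend` (XL; RH-implied; the POSITIVITY half, isolated): some finite real anchor and some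
  POSITIVE measure `ν` carried by `|t| ≥ H`, TAME (`ν[T, T+1] ≤ C log(2+|T|)`) and SUPER-NYQUIST WITH SLACK
  at a sub-cell scale (`ν[T, T+w] ≥ (1+δ)(log 3/π)·w` for one `w < 2π/log 3`, i.e. density ≥ `2(1+δ)×` the
  Landau rate `log 3/2π` of the window), realise `W` on the window: `W(g) = Σ_j ĝ(γ₀ⱼ) + ∫ ĝ dν`.
  Under RH: `γ₀` = ordinates `≤ H`, `ν = Σ_{|γ|>H} δ_γ` (explicit formula `hasSum_nontrivialZeros`; local
  counts `O(log T)`; gaps → 0 by Littlewood, so slack from some `H` on). It implies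
  `WeilPositivityOn (log 3/2)` (pair with `h ⋆ h̃`), hence is not cheap: it is the crux's positivity content
  in LINEAR form (a Kreĭn-type extension statement with a support gap), certifiable in finite sections from
  one side, and at this rung reducible to RH-to-height + a certified floor by the companion card
  `one-signed-split` (TRIAGE-r1-3 cross-idea remarks).
* `stub_crystallise` (XL; HARDEST; RH-free and ζ-free; the line's own theorem = FZC‴ of the triage): EVERY
  such datum (finite real anchor + positive tame measure with sub-cell slack on `|t| ≥ H`) is the window
  transform of a REAL UNIT-ATOMIC family: `∃ κ (γ : κ → ℝ), Σ_i ĝ(½+iγ_i) = Σ_j ĝ(γ₀ⱼ) + ∫ ĝ dν` for every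
  window Weil test. Landau's density theorem run in reverse with slack ≥ 2: crystallisation of tame
  super-Nyquist positive mass at window resolution. Engine (card §Transfer (i)–(iii), sharpened): smooth
  `ν` at a fine scale, take the symmetric quantile half-chirps of the smooth part (exact Poisson bookkeeping,
  `stub_chirp`), and remove the smooth/small/high-source remainder by a bounded real displacement field
  obtained by continuation, the linearised synthesis operator being onto by Duffin–Schaeffer frame bounds
  (`stub_frame`) applied blockwise with `log`-weights; fractional charges are pushed to infinity by
  half-cell dislocations. The anchor atoms are free to move (the conclusion does not freeze them), which is
  the interface advice of TRIAGE-r1-1 (d) / r1-3.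
* `stub_chirp` (M–L; classical): exact Poisson–Euler–Maclaurin bookkeeping of a symmetric super-Nyquist
  half-chirp in the symbol class (`|φ^{(j)}| ≤ C_j t^{1−j} log(t+2)`, `φ′ ≥ log 3/2π + δ` beyond `H`): the
  family `±φ⁻¹(n)` reproduces `∫_{t>H} (ĝ(½+it) + ĝ(½−it)) φ′(t) dt` EXACTLY up to `∫ g·A` with `A ∈ C^∞`
  (every alias `k ≠ 0` is non-stationary on `|u| ≤ log 3 < 2πkφ′`; the `±k` edge terms at `H` are paired).
* `stub_frame` (M–L; Duffin–Schaeffer 1952 Thm I in Weil vocabulary; identical in substance to card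
  `sos-witness-seeded-newton-kantorovich`'s `TailFrameBounds`, so one proof serves both lines).

RESHAPE r2 (lead c4, 2026-08-17). `stub_residualExtend` as filed by c3 asks for positivity of the FAR part of a
representer after the bottom has been replaced by unit atoms; by M. Riesz duality that is Weil-type positivity on
the cone `{ĝ ≥ 0 on |t| ≥ H}`, strictly beyond squares, and the constructive instance (certified zeros to
`3·10¹²` + smeared zeros beyond) misses by the explicit `S(T)` constants (needs `≈ 0.07 log T`, have `0.110`).
It is therefore split into its provable content and its honest residual, with the SAME composition idea
(positivity half + crystallisation half + two engines):
* `stub_bochnerWindow` (L; PROVABLE; lead): `W` is represented on a window `[-L₁, L₁]`, `L₁ > log 3`, by a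
  positive tame Borel measure (Kreĭn–Riesz extension from the landed `∃ a > log 3/2, WeilPositivityOn a`,
  Riesz–Markov–Kakutani, general smooth Boas–Kac);
* `stub_tailSlack` (M–L; PROVABLE; worker): any such representer is super-Landau with slack at a sub-Nyquist
  scale beyond some height (Selberg minorants modulated to height `T`);
* `stub_bottomCrystal` (XL; RH-implied; OPEN; lead): trade the bottom of the representer for finitely many unit
  real atoms keeping the far part positive, tame and slack — c3's datum. `ResidualExtendStatement` is now the
  theorem `residualExtendStatement_of` of these three.

TRUTH STATUS. `stub_chirp`, `stub_frame`: theorems of classical analysis (provable now, no number theory).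
`stub_bochnerWindow`, `stub_tailSlack`: theorems (provable now). `stub_bottomCrystal`: RH-implied, open.
`stub_residualExtend`: RH-implied (irrefutable short of `¬RH`), open (⊇ WeilPos #2). `stub_crystallise`:
a universal statement containing no arithmetic; trivial on the RH instance (`ν` already unit-atomic), new in
general; its hypothesis class was cut to defeat the triage counterexamples — the gap witness and the
Bohr-modulated density of TRIAGE-r1-1/r1-2 violate nothing here because the conclusion no longer pins atoms
to a FIXED chirp, long thin stretches are excluded by slack at scale `w`, and window-resonant heavy lattices
`m·Σδ_{sn}` (`s ≥ 2π/log 3`, `m ∉ ℤ`), which are NOT crystallisable, are excluded because `w < 2π/log 3 ≤ s`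
leaves an empty interval `[T, T+w]`.

DISPROOF USED (`Cruxes/WindowTracePrime2/Disproof.lean`, cycle 1 + §(W)). (L)
`windowTracePrime2_false_without_IsWeilTest`: `IsWeilTest` is used at `stub_chirp` (decay of `ĝ` makes the
chirp sum a `HasSum` and the alias kernels smooth), at `stub_crystallise` (same) and at `stub_residualExtend`
(`∫ ĝ dν` converges against `log`-bounded local mass only because `ĝ` decays); realness
(`windowTracePrime2WithoutReal_holds`) is the whole content and enters twice: positivity of `ν`
(`stub_residualExtend`) and real atoms (`stub_crystallise`). (S) `not_trace_of_finite`,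
`finite_abs_le_of_trace`, `not_trace_progressions`: the output of `stub_crystallise` is infinite (slack forces
`ν(ℝ) = ∞`), locally finite, and no finite union of progressions (its window transform contains the a.c.
density of `W`, cf. `weilFunctional_bumpC_re_pos`, BN8). (W) `ncard_near_le`,
`re_weilFunctional_modulate_ge/le`, `hasSum_norm_sq_shift`: the tameness and slack clauses of
`stub_residualExtend` are the measure form of exactly these witness laws (necessary for any positive
realiser), so they cost nothing in truth value. `tsum_lineSample`: the un-chirped case of `stub_chirp`.
No refuted strengthening is instantiated; `ledger negatives`: 0. The six landed `Negative/*` files are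
imported above as a scratch check.
-/

set_option linter.dupNamespace false

noncomputable section

open Complex Filter Set MeasureTheory
open scoped Real Topology BigOperators ContDiff

namespace Summit.RiemannHypothesis.RiemannHypothesis.Cruxes.WindowTracePrime2.AnchorFloat

open Literature.NumberTheory.LFunctions
open Summit.RiemannHypothesis.RiemannHypothesis.Theses.SpectralTrace

/-! ## The statements (named `Prop`s; the registered `stub_*` theorems below restate them verbatim and
fully qualified; `Registered.stub_*` are the name-keyed aliases taken as hypotheses of `WindowTracePrime2_of`
— same device as `Cruxes/WindowTraceArch/Lines/defect_compactness_design.lean`). -/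

/-- Statement of `stub_bochnerWindow` (RESHAPE r2, lead c4; the PROVABLE part of the positivity half):
Bochner–Kreĭn representation of `W` on a window STRICTLY LARGER than `[-log 3, log 3]` by a positive, tame
Borel measure: `W(g) = ∫ ĝ(½+it) dμ(t)` for every Weil test supported in `[-L₁, L₁]`, some `L₁ > log 3`. -/
def BochnerWindowStatement : Prop :=
    ∃ (μ : Measure ℝ) (L₁ C : ℝ), Real.log 3 < L₁ ∧
      (∀ T : ℝ, μ (Icc T (T + 1)) ≤ ENNReal.ofReal (C * Real.log (2 + |T|))) ∧
      ∀ g : ℝ → ℂ, IsWeilTest g → tsupport g ⊆ Icc (-L₁) L₁ →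
        Integrable (fun t : ℝ => weilMellin g (1 / 2 + (t : ℂ) * I)) μ ∧
        weilFunctional g = ∫ t, weilMellin g (1 / 2 + (t : ℂ) * I) ∂μ

/-- Statement of `stub_tailSlack` (RESHAPE r2; provable): every positive representer of `W` on a window
`[-L₁, L₁]`, `L₁ > log 3`, has density at least `2(1+δ)×` the Landau rate `log 3/2π` at some sub-Nyquist scale
`w < 2π/log 3`, on both sides, beyond some height `H` (Selberg minorants of bandwidth `< L₁` for intervals of
length `w > 2π/L₁`, modulated to height `T`; the archimedean term grows like `(1/2π) log|T| · mass`). -/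
def TailSlackStatement : Prop :=
    ∀ (μ : Measure ℝ) (L₁ : ℝ), Real.log 3 < L₁ →
      (∀ g : ℝ → ℂ, IsWeilTest g → tsupport g ⊆ Icc (-L₁) L₁ →
        Integrable (fun t : ℝ => weilMellin g (1 / 2 + (t : ℂ) * I)) μ ∧
        weilFunctional g = ∫ t, weilMellin g (1 / 2 + (t : ℂ) * I) ∂μ) →
      ∃ (H δ w : ℝ), 1 ≤ H ∧ 0 < δ ∧ 0 < w ∧ w < 2 * Real.pi / Real.log 3 ∧
        (∀ T : ℝ, H ≤ T → ENNReal.ofReal ((1 + δ) * (Real.log 3 / Real.pi) * w) ≤ μ (Icc T (T + w))) ∧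
        (∀ T : ℝ, T ≤ -H → ENNReal.ofReal ((1 + δ) * (Real.log 3 / Real.pi) * w) ≤ μ (Icc (T - w) T))

/-- Statement of `stub_residualExtend` (c3's positivity half, now a DERIVED statement: it follows from
`stub_bochnerWindow`, `stub_tailSlack` and `stub_bottomCrystal`): a finite real anchor plus a positive, tame,
super-Nyquist-with-slack measure carried by `|t| ≥ H` realise `W` on the window `[-log 3, log 3]`. -/
def ResidualExtendStatement : Prop :=
    ∃ (H δ C w : ℝ) (m : ℕ) (γ₀ : Fin m → ℝ) (ν : Measure ℝ),
      1 ≤ H ∧ 0 < δ ∧ 0 < w ∧ w < 2 * Real.pi / Real.log 3 ∧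
      ν (Ioo (-H) H) = 0 ∧
      (∀ T : ℝ, ν (Icc T (T + 1)) ≤ ENNReal.ofReal (C * Real.log (2 + |T|))) ∧
      (∀ T : ℝ, H ≤ T → ENNReal.ofReal ((1 + δ) * (Real.log 3 / Real.pi) * w) ≤ ν (Icc T (T + w))) ∧
      (∀ T : ℝ, T ≤ -H → ENNReal.ofReal ((1 + δ) * (Real.log 3 / Real.pi) * w) ≤ ν (Icc (T - w) T)) ∧
      ∀ g : ℝ → ℂ, IsWeilTest g → tsupport g ⊆ Icc (-Real.log 3) (Real.log 3) →
        weilFunctional g =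
          (∑ j, weilMellin g (1 / 2 + (γ₀ j : ℂ) * I)) + ∫ t, weilMellin g (1 / 2 + (t : ℂ) * I) ∂ν

/-- Statement of `stub_bottomCrystal` (RESHAPE r2; the honest RESIDUAL of the positivity half; RH-implied,
open): a positive tame representer of `W` on a window `[-L₁, L₁] ⊋ [-log 3, log 3]` with sub-Nyquist slack
beyond `H` can be traded for c3's datum — finitely many UNIT REAL atoms plus a positive tame slack measure carried
by `|t| ≥ H'` — without changing the window transform on `[-log 3, log 3]`. -/
def BottomCrystalStatement : Prop :=
    ∀ (μ : Measure ℝ) (L₁ C H δ w : ℝ), Real.log 3 < L₁ →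
      (∀ T : ℝ, μ (Icc T (T + 1)) ≤ ENNReal.ofReal (C * Real.log (2 + |T|))) →
      (∀ g : ℝ → ℂ, IsWeilTest g → tsupport g ⊆ Icc (-L₁) L₁ →
        Integrable (fun t : ℝ => weilMellin g (1 / 2 + (t : ℂ) * I)) μ ∧
        weilFunctional g = ∫ t, weilMellin g (1 / 2 + (t : ℂ) * I) ∂μ) →
      1 ≤ H → 0 < δ → 0 < w → w < 2 * Real.pi / Real.log 3 →
      (∀ T : ℝ, H ≤ T → ENNReal.ofReal ((1 + δ) * (Real.log 3 / Real.pi) * w) ≤ μ (Icc T (T + w))) →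
      (∀ T : ℝ, T ≤ -H → ENNReal.ofReal ((1 + δ) * (Real.log 3 / Real.pi) * w) ≤ μ (Icc (T - w) T)) →
      ResidualExtendStatement

/-- Statement of `stub_chirp` (exact Poisson bookkeeping of a symmetric super-Nyquist half-chirp in the
symbol class). -/
def ChirpStatement : Prop :=
    ∀ (φ : ℝ → ℝ) (H δ : ℝ) (Cφ : ℕ → ℝ) (γ : ℕ → ℝ), 1 ≤ H → 0 < δ → ContDiff ℝ ∞ φ → φ H = 0 →
      (∀ t, H ≤ t → Real.log 3 / (2 * Real.pi) + δ ≤ deriv φ t) →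
      (∀ (j : ℕ) (t : ℝ), 1 ≤ j → H ≤ t →
        |iteratedDeriv j φ t| ≤ Cφ j * t ^ (1 - (j : ℝ)) * Real.log (t + 2)) →
      (∀ n, H ≤ γ n ∧ φ (γ n) = n) →
      ∃ A : ℝ → ℂ, ContDiff ℝ ∞ A ∧
        ∀ g : ℝ → ℂ, IsWeilTest g → tsupport g ⊆ Icc (-Real.log 3) (Real.log 3) →
          HasSum (fun p : ℕ ⊕ ℕ => weilMellin g (1 / 2 + ((Sum.elim γ (fun n => -γ n) p : ℝ) : ℂ) * I))
            ((∫ t in Ioi H, (weilMellin g (1 / 2 + (t : ℂ) * I) + weilMellin g (1 / 2 - (t : ℂ) * I)) *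
                ((deriv φ t : ℝ) : ℂ)) + ∫ u, g u * A u)

/-- Statement of `stub_frame` (Duffin–Schaeffer 1952, Thm I, in Weil vocabulary: exponentials with
frequencies uniformly close to a lattice of density `d` and separated form a frame on every window
shorter than `πd`). -/
def FrameStatement : Prop :=
    ∀ (Λ : ℤ → ℝ) (d M s a : ℝ), 0 < d → 0 < s → 0 < a → a < Real.pi * d →
      (∀ n, |Λ n - (n : ℝ) / d| ≤ M) → (∀ m n, m ≠ n → s ≤ |Λ m - Λ n|) →
      ∃ A B : ℝ, 0 < A ∧ A ≤ B ∧
        ∀ g : ℝ → ℂ, IsWeilTest g → tsupport g ⊆ Icc (-a) a →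
          Summable (fun n => ‖weilMellin g (1 / 2 + (Λ n : ℂ) * I)‖ ^ 2) ∧
          A * ∫ u, ‖g u‖ ^ 2 ≤ ∑' n, ‖weilMellin g (1 / 2 + (Λ n : ℂ) * I)‖ ^ 2 ∧
          ∑' n, ‖weilMellin g (1 / 2 + (Λ n : ℂ) * I)‖ ^ 2 ≤ B * ∫ u, ‖g u‖ ^ 2

/-- Statement of `stub_crystallise` (FZC‴: free-zone crystallisation), fed the two engines. -/
def CrystalliseStatement : Prop :=
    ChirpStatement → FrameStatement →
    ∀ (H δ C w : ℝ) (m : ℕ) (γ₀ : Fin m → ℝ) (ν : Measure ℝ),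
      1 ≤ H → 0 < δ → 0 < w → w < 2 * Real.pi / Real.log 3 →
      ν (Ioo (-H) H) = 0 →
      (∀ T : ℝ, ν (Icc T (T + 1)) ≤ ENNReal.ofReal (C * Real.log (2 + |T|))) →
      (∀ T : ℝ, H ≤ T → ENNReal.ofReal ((1 + δ) * (Real.log 3 / Real.pi) * w) ≤ ν (Icc T (T + w))) →
      (∀ T : ℝ, T ≤ -H → ENNReal.ofReal ((1 + δ) * (Real.log 3 / Real.pi) * w) ≤ ν (Icc (T - w) T)) →
      ∃ (κ : Type) (γ : κ → ℝ),
        ∀ g : ℝ → ℂ, IsWeilTest g → tsupport g ⊆ Icc (-Real.log 3) (Real.log 3) →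
          HasSum (fun i => weilMellin g (1 / 2 + (γ i : ℂ) * I))
            ((∑ j, weilMellin g (1 / 2 + (γ₀ j : ℂ) * I)) + ∫ t, weilMellin g (1 / 2 + (t : ℂ) * I) ∂ν)

/-! ## The registered stubs (signatures spelled out verbatim; `sorry` lives only here) -/

/-- **stub_bochnerWindow — Bochner–Kreĭn representation of `W` beyond the first arithmetic rung (L; PROVABLE
now; held by the lead).** There are a positive Borel measure `μ` on `ℝ`, a window half-width `L₁ > log 3` and a
constant `C` with: `μ[T, T+1] ≤ C log(2+|T|)` for all `T` (tame), and for every Weil test `g` supported in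
`[−L₁, L₁]`, `t ↦ ĝ(½+it)` is `μ`-integrable and `W(g) = ∫ ĝ(½+it) dμ(t)`. Proof: Weil positivity is PROVED
strictly beyond Yoshida's rung — `∃ a > log 3/2, WeilPositivityOn a`
(`SpectralTraceWindowStep.exists_weilPositivityOn_gt_log_three_half`, p141362, from the kernel-checked
certificate margin `0 < ε(log 3/2)`); take `log 3 < L₁ < 2a`. Kreĭn's extension theorem in M. Riesz form
(Mathlib `riesz_extension`) on `E = p + C_c(ℝ)`, `p` = transforms `t ↦ k̂(½+it)` of hermitian tests `k`
supported in `[−2a', 2a']` (`L₁ < 2a' < 2a`), cone = pointwise non-negative elements: (i) `k̂ ≥ 0` on the line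
⇒ `k = φ ⋆ φ̃` with `supp φ ⊆ [−a', a']` (general smooth Boas–Kac 1945 Thm 1 = Kreĭn's factorisation, by
Poisson summation + Fejér–Riesz + the tree's lattice pipeline `BoasKacFourierSide`) ⇒ `W(k) = Q(φ) ≥ 0`;
(ii) cofinality: `M|φ̂₀|² + c ≥ 0` for a thin bump `φ₀` (`re_weilMellin_bump_ge`). Riesz–Markov–Kakutani
(Mathlib `RealRMK.rieszMeasure`) gives `μ`; the identity for non-negative `k̂` by the sandwich
`(1 − χ_n)k̂ ≤ t²k̂/n² = (−k″)^/n²`; tameness from `re_weilFunctional_modulate_le`; all window tests by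
polarisation of translated pieces `τ_{c/2}(k⁰ ⋆ β) ⋆ (τ_{−c/2}β)~` and the mollifier limit `β_ε ⋆ β̃_ε → δ`
(dominated convergence on both sides). Reusable verbatim at the windows `log 2` (Arch) and `log 3` (this crux).
Why it might fail: only by mis-typing (existence is forced by proved positivity). Sources: Kreĭn 1940
(extension of p.d. functions from an interval); M. Riesz 1923; Boas–Kac 1945 Thm 1; Bochner–Schwartz;
Bombieri2000Weil §4; tree p123790, p141362. -/
theorem stub_bochnerWindow :
    ∃ (μ : MeasureTheory.Measure ℝ) (L₁ C : ℝ), Real.log 3 < L₁ ∧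
      (∀ T : ℝ, μ (Set.Icc T (T + 1)) ≤ ENNReal.ofReal (C * Real.log (2 + |T|))) ∧
      ∀ g : ℝ → ℂ, Literature.NumberTheory.LFunctions.IsWeilTest g →
        tsupport g ⊆ Set.Icc (-L₁) L₁ →
        MeasureTheory.Integrable
            (fun t : ℝ => Literature.NumberTheory.LFunctions.weilMellin g (1 / 2 + (t : ℂ) * Complex.I)) μ ∧
          Literature.NumberTheory.LFunctions.weilFunctional g =
            ∫ t, Literature.NumberTheory.LFunctions.weilMellin g (1 / 2 + (t : ℂ) * Complex.I) ∂μ := by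
  sorry

/-- **stub_tailSlack — every positive representer is super-Landau beyond some height (M–L; PROVABLE now).**
If a positive Borel measure `μ` represents `W` on the Weil tests supported in `[−L₁, L₁]` for some `L₁ > log 3`
(`W(g) = ∫ ĝ(½+it) dμ`, integrably), then for some `H ≥ 1`, `δ > 0` and a sub-Nyquist scale
`0 < w < 2π/log 3`: `μ[T, T+w] ≥ (1+δ)(log 3/π)·w` for `T ≥ H` and `μ[T−w, T] ≥ …` for `T ≤ −H`. Proof:
pick `w ∈ (2π/L₁, 2π/log 3)` and `η > 0`, `Δ = (L₁ − 2η)/(2π)` with `w > 1/Δ`; let `F₋` be Selberg's minorant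
of `[0, w]` (`Literature.Analysis.Fourier.selbergMinorant`, `selbergMinorantReal_le_indicator_Icc`,
`integral_selbergMinorantReal = w − 1/Δ > 0`, Fourier support `[−Δ, Δ]`: `fourier_selbergMinorant_eq_zero`),
`g₀ := F̌₋ ⋆ (β ⋆ β̃)` with `β` a bump in `[−η, η]` — a Weil test supported in `[−L₁, L₁]` with
`ĝ₀ = F₋|β̂|² ≤ 𝟙_{[0,w]}` and `∫ ĝ₀ > 0`; modulate, `g_T(x) = g₀(x)e^{−iTx}` (`Negative.isWeilTest_modulate`,
`weilMellin_modulate`): `μ[T, T+w] ≥ ∫ ĝ_T dμ = Re W(g_T) = (1/2π)(∫ĝ₀) log|T| + O(1)` (polar and prime terms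
bounded: `norm_weilPolarTerm_modulate_le`, `norm_weilPrimeTerm_modulate_le`; archimedean term by
`abs_re_digamma_sub_log_norm_le` / `log_norm_sub_le_re_digamma` against the rapidly decaying `ĝ₀`), which
exceeds `(1+δ)(log 3/π)w` for `|T| ≥ H`. Why it might fail: only by mis-typing. Sources: Selberg/Vaaler 1985
Thm 8; Beurling; tree `SelbergMajorants*.lean`, `Negative/Modulation.lean`, `Negative/ArchBound.lean`. -/
theorem stub_tailSlack :
    ∀ (μ : MeasureTheory.Measure ℝ) (L₁ : ℝ), Real.log 3 < L₁ →
      (∀ g : ℝ → ℂ, Literature.NumberTheory.LFunctions.IsWeilTest g →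
        tsupport g ⊆ Set.Icc (-L₁) L₁ →
        MeasureTheory.Integrable
            (fun t : ℝ => Literature.NumberTheory.LFunctions.weilMellin g (1 / 2 + (t : ℂ) * Complex.I)) μ ∧
          Literature.NumberTheory.LFunctions.weilFunctional g =
            ∫ t, Literature.NumberTheory.LFunctions.weilMellin g (1 / 2 + (t : ℂ) * Complex.I) ∂μ) →
      ∃ (H δ w : ℝ), 1 ≤ H ∧ 0 < δ ∧ 0 < w ∧ w < 2 * Real.pi / Real.log 3 ∧
        (∀ T : ℝ, H ≤ T →
          ENNReal.ofReal ((1 + δ) * (Real.log 3 / Real.pi) * w) ≤ μ (Set.Icc T (T + w))) ∧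
        (∀ T : ℝ, T ≤ -H →
          ENNReal.ofReal ((1 + δ) * (Real.log 3 / Real.pi) * w) ≤ μ (Set.Icc (T - w) T)) := by
  sorry

/-- **stub_bottomCrystal — crystallising the bottom of a positive representer (XL; RH-implied; OPEN; the
honest residual of c3's `stub_residualExtend`, held by the lead).** Given a positive tame measure `μ`
representing `W` on `[−L₁, L₁]`, `L₁ > log 3`, with sub-Nyquist slack beyond `H` (the outputs of
`stub_bochnerWindow` and `stub_tailSlack`), produce c3's datum: finitely many UNIT REAL atoms `γ₀` and a positive
tame slack measure `ν` carried by `|t| ≥ H'` with `W(g) = Σ_j ĝ(γ₀ⱼ) + ∫ ĝ dν` on the window `[−log 3, log 3]`.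
Under RH: `γ₀` = zeta ordinates below `H'`, `ν` = the rest (ignore `μ`). Why it is the residual and why it
might fail: the bottom `μ|(−H', H')` of a representer is NOT determined by `W` at scales `< 2π/L₁`, but any
replacement by unit atoms leaves a defect whose prolate (band-limited, `[−H', H']`-concentrated) components
must vanish to accuracy `e^{−L₁H'}` before the far zone can absorb it positively (uncertainty principle for
the pair `(supp ⊆ [−H', H'], spectrum ⊆ [−L₁, L₁])`); the only known configuration doing so is the true
zeros, and certifying that the far compensation stays POSITIVE is Weil-type positivity on the cone
`{ĝ ≥ 0 on |t| ≥ H'}` — beyond squares, i.e. beyond `WeilPositivityOn`. Quantitatively (lead c4): with RH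
to height `3·10¹²` (Platt–Trudgian) the projected/smeared far zeros give a positive density only if
`sup|S(T)| ≲ 0.07 log T` there, vs the explicit `0.110 log T + 0.290 log log T + 2.290`. Sources:
Landau–Pollak–Slepian (prolates); KreinLanger2014; PlattTrudgian2021; Trudgian 2014 / Platt–Trudgian 2015
(`S(T)`); c3 `Lines/anchor-float.md`. -/
theorem stub_bottomCrystal :
    ∀ (μ : MeasureTheory.Measure ℝ) (L₁ C H δ w : ℝ), Real.log 3 < L₁ →
      (∀ T : ℝ, μ (Set.Icc T (T + 1)) ≤ ENNReal.ofReal (C * Real.log (2 + |T|))) →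
      (∀ g : ℝ → ℂ, Literature.NumberTheory.LFunctions.IsWeilTest g →
        tsupport g ⊆ Set.Icc (-L₁) L₁ →
        MeasureTheory.Integrable
            (fun t : ℝ => Literature.NumberTheory.LFunctions.weilMellin g (1 / 2 + (t : ℂ) * Complex.I)) μ ∧
          Literature.NumberTheory.LFunctions.weilFunctional g =
            ∫ t, Literature.NumberTheory.LFunctions.weilMellin g (1 / 2 + (t : ℂ) * Complex.I) ∂μ) →
      1 ≤ H → 0 < δ → 0 < w → w < 2 * Real.pi / Real.log 3 →
      (∀ T : ℝ, H ≤ T →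
        ENNReal.ofReal ((1 + δ) * (Real.log 3 / Real.pi) * w) ≤ μ (Set.Icc T (T + w))) →
      (∀ T : ℝ, T ≤ -H →
        ENNReal.ofReal ((1 + δ) * (Real.log 3 / Real.pi) * w) ≤ μ (Set.Icc (T - w) T)) →
      ∃ (H' δ' C' w' : ℝ) (m : ℕ) (γ₀ : Fin m → ℝ) (ν : MeasureTheory.Measure ℝ),
        1 ≤ H' ∧ 0 < δ' ∧ 0 < w' ∧ w' < 2 * Real.pi / Real.log 3 ∧
        ν (Set.Ioo (-H') H') = 0 ∧
        (∀ T : ℝ, ν (Set.Icc T (T + 1)) ≤ ENNReal.ofReal (C' * Real.log (2 + |T|))) ∧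
        (∀ T : ℝ, H' ≤ T →
          ENNReal.ofReal ((1 + δ') * (Real.log 3 / Real.pi) * w') ≤ ν (Set.Icc T (T + w'))) ∧
        (∀ T : ℝ, T ≤ -H' →
          ENNReal.ofReal ((1 + δ') * (Real.log 3 / Real.pi) * w') ≤ ν (Set.Icc (T - w') T)) ∧
        ∀ g : ℝ → ℂ, Literature.NumberTheory.LFunctions.IsWeilTest g →
          tsupport g ⊆ Set.Icc (-Real.log 3) (Real.log 3) →
          Literature.NumberTheory.LFunctions.weilFunctional g =
            (∑ j, Literature.NumberTheory.LFunctions.weilMellin g (1 / 2 + (γ₀ j : ℂ) * Complex.I)) +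
              ∫ t, Literature.NumberTheory.LFunctions.weilMellin g (1 / 2 + (t : ℂ) * Complex.I) ∂ν := by
  sorry

/-- **stub_chirp — exact Poisson bookkeeping of a symmetric super-Nyquist half-chirp (M–L; classical
non-stationary phase + Euler–Maclaurin; provable now).** Let `φ` be smooth on `ℝ` with `φ(H) = 0`
(`H ≥ 1`), slope at least the Landau rate plus a margin, `φ′(t) ≥ log 3/(2π) + δ` for `t ≥ H`, and symbol
bounds `|φ^{(j)}(t)| ≤ C_j t^{1−j} log(t+2)` (`j ≥ 1`, `t ≥ H`; e.g. the arch density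
`φ′ = (1/2π) log(t/2π)`); let `γ_n ≥ H` solve `φ(γ_n) = n` (`n ∈ ℕ`; so `γ₀ = H`). Then there is
`A ∈ C^∞(ℝ → ℂ)` such that for every Weil test `g` supported in `[−log 3, log 3]` the symmetric family
`{±γ_n}` satisfies `Σ_n [ĝ(½+iγ_n) + ĝ(½−iγ_n)] = ∫_{t>H} (ĝ(½+it) + ĝ(½−it)) φ′(t) dt + ∫ g(u) A(u) du`
as a `HasSum` over `ℕ ⊕ ℕ`. Proof: Poisson/Euler–Maclaurin in the variable `φ`:
`Σ_{n≥0} F(φ⁻¹ n) = ∫_H^∞ F φ′ + ½F(H) + Σ_{k≠0} ∫_H^∞ F φ′ e^{2πikφ}` with `F = ĝ(½ ± i·)`; the alias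
kernels `A_k(u) = ∫_H^∞ φ′ e^{i(ut + 2πkφ)} dt` have phase derivative `u + 2πkφ′ ≥ 2πkδ` for
`|u| ≤ log 3 + πδ` (NO stationary point: `2πφ′ > log 3`), so `m + 2` integrations by parts (each gaining
`t⁻¹` from the symbol bounds) give `A_k ∈ C^m` with norms `O_m(k^{−m−2})`; the first boundary terms
`φ′(H)e^{iuH}/(i(u ± 2πkφ′(H)))` are paired over `±k` (sum `O(k⁻²)`); `A :=` a cutoff equal to `1` on the
window times (`½e^{iuH}` + the paired alias sum), symmetrised `u ↦ −u`; the series over `n` converges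
absolutely since `γ_n → ∞` at least like `n/log n` and `ĝ` decays faster than any power
(`weilMellin_deriv`-type bounds). Tree: `Negative.tsum_lineSample` is the un-chirped case
(`φ(t) = (t − β)/α`, where `A_k` are Dirac masses OUTSIDE the window). Why it might fail: only by
mis-typing (it is a theorem); note the symbol class deliberately EXCLUDES the prime-2 ripple in `φ′`
(TRIAGE-r1-1: with a bounded non-decaying `φ″` the alias kernel is a Weierstrass-type function of finite
smoothness) — ripples are carried by `ν`, not by `φ`. Sources: Olver, Asymptotics and Special Functions
Ch. 8 (Euler–Maclaurin/Abel–Plana); Stein, Harmonic Analysis Ch. VIII §1 (non-stationary phase);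
Mathlib `Real.tsum_eq_tsum_fourierIntegral`. -/
theorem stub_chirp :
    ∀ (φ : ℝ → ℝ) (H δ : ℝ) (Cφ : ℕ → ℝ) (γ : ℕ → ℝ), 1 ≤ H → 0 < δ → ContDiff ℝ ∞ φ → φ H = 0 →
      (∀ t, H ≤ t → Real.log 3 / (2 * Real.pi) + δ ≤ deriv φ t) →
      (∀ (j : ℕ) (t : ℝ), 1 ≤ j → H ≤ t →
        |iteratedDeriv j φ t| ≤ Cφ j * t ^ (1 - (j : ℝ)) * Real.log (t + 2)) →
      (∀ n, H ≤ γ n ∧ φ (γ n) = n) →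
      ∃ A : ℝ → ℂ, ContDiff ℝ ∞ A ∧
        ∀ g : ℝ → ℂ, Literature.NumberTheory.LFunctions.IsWeilTest g →
          tsupport g ⊆ Set.Icc (-Real.log 3) (Real.log 3) →
          HasSum (fun p : ℕ ⊕ ℕ =>
              Literature.NumberTheory.LFunctions.weilMellin g
                (1 / 2 + ((Sum.elim γ (fun n => -γ n) p : ℝ) : ℂ) * Complex.I))
            ((∫ t in Set.Ioi H,
                (Literature.NumberTheory.LFunctions.weilMellin g (1 / 2 + (t : ℂ) * Complex.I) +
                  Literature.NumberTheory.LFunctions.weilMellin g (1 / 2 - (t : ℂ) * Complex.I)) *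
                ((deriv φ t : ℝ) : ℂ)) + ∫ u, g u * A u) := by
  sorry

/-- **stub_frame — Duffin–Schaeffer frames of exponentials in Weil vocabulary (M–L; a 1952 theorem, to
vendor; shared verbatim in substance with `sos-witness-seeded-newton-kantorovich`'s `TailFrameBounds`).**
If `Λ : ℤ → ℝ` is uniformly close to the lattice of density `d` (`|Λ_n − n/d| ≤ M`) and separated
(`|Λ_m − Λ_n| ≥ s > 0`), then for every `a < πd` there are `0 < A ≤ B` with
`A ∫|g|² ≤ Σ_n |ĝ(½ + iΛ_n)|² ≤ B ∫|g|²` for every Weil test `g` supported in `[−a, a]` (the sum being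
summable). This is Duffin–Schaeffer, Trans. AMS 72 (1952) Thm I (density-`1` case `|λ_n − n| ≤ L`, frame for
`L²(−γ, γ)`, `γ < π`), rescaled by `d`; stated on the dense subspace `C_c^∞` (equivalent). Used by
`stub_crystallise` blockwise on separated subsequences of the float (local density `≥ (1+δ) log 3/π`, window
`a` slightly larger than `log 3`: `a < π · (1+δ) log 3/π`), with `log`-weights across blocks because the
whole family is not Bessel (`Negative` (W): local counts `~ log T`). Why it might fail: only by mis-typing.
Sources: Duffin–Schaeffer 1952 Thm I; Young, An Introduction to Nonharmonic Fourier Series (2001) Ch. 4 §7;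
Christensen, An Introduction to Frames and Riesz Bases (2003) Thm 9.8.x; Seip 1995 / Ortega-Cerdà–Seip
2002 (sharp density form, not needed). -/
theorem stub_frame :
    ∀ (Λ : ℤ → ℝ) (d M s a : ℝ), 0 < d → 0 < s → 0 < a → a < Real.pi * d →
      (∀ n, |Λ n - (n : ℝ) / d| ≤ M) → (∀ m n, m ≠ n → s ≤ |Λ m - Λ n|) →
      ∃ A B : ℝ, 0 < A ∧ A ≤ B ∧
        ∀ g : ℝ → ℂ, Literature.NumberTheory.LFunctions.IsWeilTest g → tsupport g ⊆ Set.Icc (-a) a →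
          Summable (fun n =>
            ‖Literature.NumberTheory.LFunctions.weilMellin g (1 / 2 + (Λ n : ℂ) * Complex.I)‖ ^ 2) ∧
          A * ∫ u, ‖g u‖ ^ 2 ≤
            ∑' n, ‖Literature.NumberTheory.LFunctions.weilMellin g (1 / 2 + (Λ n : ℂ) * Complex.I)‖ ^ 2 ∧
          ∑' n, ‖Literature.NumberTheory.LFunctions.weilMellin g (1 / 2 + (Λ n : ℂ) * Complex.I)‖ ^ 2 ≤
            B * ∫ u, ‖g u‖ ^ 2 := by
  sorry

/-- **stub_crystallise — free-zone crystallisation FZC‴ (XL; HARDEST; load-bearing; RH-free, ζ-free).**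
Given the chirp bookkeeping and the frame bounds: for every height `H ≥ 1`, slack `δ > 0`, tameness
constant `C`, sub-cell scale `0 < w < 2π/log 3`, every finite real anchor `γ₀ : Fin m → ℝ` and every
POSITIVE measure `ν` carried by `|t| ≥ H` with `ν[T,T+1] ≤ C log(2+|T|)` (all `T`) and
`ν[T, T+w] ≥ (1+δ)(log 3/π) w` on both sides of the free zone (`T ≥ H`, resp. `[T−w, T]` for `T ≤ −H`),
there is a REAL family `γ : κ → ℝ` of UNIT atoms with
`Σ_i ĝ(½+iγ_i) = Σ_j ĝ(½+iγ₀ⱼ) + ∫ ĝ(½+it) dν(t)` (`HasSum`) for every Weil test `g` supported in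
`[−log 3, log 3]`. Meaning: positive mass that is tame and has density ≥ `2(1+δ)×` the Landau rate
`log 3/2π` everywhere in the free zone, at a scale finer than one Nyquist cell `2π/log 3 ≈ 5.72`, can be
re-quantised into unit atoms without changing its transform on the window — Landau's necessary density for
unit masses (`Λ_L ≥ 1`; `Negative` UnitMass zones of the sibling crux) turned into a SUFFICIENT condition
with factor `2` (the completeness radius `π·density ≥ log 3` of the float's exponentials on the full window,
Beurling–Malliavin; edge atoms at `t = H` cost exactly twice the bulk budget, so `2(1+δ)` is also the
Christoffel threshold at the support edge). The anchor is free to move in the conclusion. Intended proof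
(card §Transfer, sharpened by TRIAGE-r1-1/3): (i) smooth `ν` at a fine scale, `ρ := (ν ∗ η)` has symbol
bounds and `ρ ≥ (1+δ′) log 3/π`; split `ρ = φ′ + (ρ − φ′)` with `φ′` in the symbol class of `stub_chirp`
(coarse part) and realise `∫ ĝ φ′` exactly by the symmetric quantile half-chirps (`stub_chirp`), leaving an
EXPLICIT remainder `∫ ĝ d(ν − φ′dt − ghost) − ∫ g A` that is small in the prolate directions and
`log`-tame in the high ones; (ii) continuation `s ∈ [0,1]` along `s`·remainder with the displacement ODE
`ṫ = J(t)⁺[remainder]`, `J` = synthesis operator of `{(iu) e^{it_n u}}` on `L²(−L′, L′)`, `L′ = (1+δ/2) log 3`,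
onto with blockwise right inverse from `stub_frame` (local density `(1+δ) log 3/π > L′/π`) and `log`-weights;
(iii) integrality defects (non-integer local masses of `ν`, the `½`-atom Euler–Maclaurin edge at `H`, the
anchor/float junction) are ABSORBED by half-cell dislocations of the float (a shift of all atoms beyond `t₀`
by a fraction of the local spacing carries any fractional charge to infinity at bounded displacement).
Cheap attacks already answered (this file's docstring): gap witness / Bohr-modulated density / thin
stretches / window-resonant heavy lattices. Why it might fail: slack `2(1+δ)` might not suffice UNIFORMLY
for very irregular `ν` (frame lower bounds degrade with irregularity while the remainder does not shrink) —
the statement would then need slack `≥ c₀` absolute, a repair, not a kill; a genuine kill is a positive tame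
`ν` with sub-cell slack whose window transform no integer-atomic real measure reproduces. Sources: Landau
1967 (Acta Math. 117) necessary densities; Beurling–Malliavin 1967; Duffin–Schaeffer 1952; Seip 1995;
Olevskii–Ulanovskii, Functions with Disconnected Spectrum (AMS ULS 65, 2016) Ch. 3–5;
Bondarenko–Radchenko–Viazovska 2013 (equal-weight designs: the finite-dimensional model of (iii));
arXiv:2106.01715 §5; TRIAGE-r1-1 §anchor-float (FZC″/FZC‴), TRIAGE-r1-3 §anchor-float. -/
theorem stub_crystallise :
    (∀ (φ : ℝ → ℝ) (H δ : ℝ) (Cφ : ℕ → ℝ) (γ : ℕ → ℝ), 1 ≤ H → 0 < δ → ContDiff ℝ ∞ φ → φ H = 0 →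
      (∀ t, H ≤ t → Real.log 3 / (2 * Real.pi) + δ ≤ deriv φ t) →
      (∀ (j : ℕ) (t : ℝ), 1 ≤ j → H ≤ t →
        |iteratedDeriv j φ t| ≤ Cφ j * t ^ (1 - (j : ℝ)) * Real.log (t + 2)) →
      (∀ n, H ≤ γ n ∧ φ (γ n) = n) →
      ∃ A : ℝ → ℂ, ContDiff ℝ ∞ A ∧
        ∀ g : ℝ → ℂ, Literature.NumberTheory.LFunctions.IsWeilTest g →
          tsupport g ⊆ Set.Icc (-Real.log 3) (Real.log 3) →
          HasSum (fun p : ℕ ⊕ ℕ =>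
              Literature.NumberTheory.LFunctions.weilMellin g
                (1 / 2 + ((Sum.elim γ (fun n => -γ n) p : ℝ) : ℂ) * Complex.I))
            ((∫ t in Set.Ioi H,
                (Literature.NumberTheory.LFunctions.weilMellin g (1 / 2 + (t : ℂ) * Complex.I) +
                  Literature.NumberTheory.LFunctions.weilMellin g (1 / 2 - (t : ℂ) * Complex.I)) *
                ((deriv φ t : ℝ) : ℂ)) + ∫ u, g u * A u)) →
    (∀ (Λ : ℤ → ℝ) (d M s a : ℝ), 0 < d → 0 < s → 0 < a → a < Real.pi * d →
      (∀ n, |Λ n - (n : ℝ) / d| ≤ M) → (∀ m n, m ≠ n → s ≤ |Λ m - Λ n|) →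
      ∃ A B : ℝ, 0 < A ∧ A ≤ B ∧
        ∀ g : ℝ → ℂ, Literature.NumberTheory.LFunctions.IsWeilTest g → tsupport g ⊆ Set.Icc (-a) a →
          Summable (fun n =>
            ‖Literature.NumberTheory.LFunctions.weilMellin g (1 / 2 + (Λ n : ℂ) * Complex.I)‖ ^ 2) ∧
          A * ∫ u, ‖g u‖ ^ 2 ≤
            ∑' n, ‖Literature.NumberTheory.LFunctions.weilMellin g (1 / 2 + (Λ n : ℂ) * Complex.I)‖ ^ 2 ∧
          ∑' n, ‖Literature.NumberTheory.LFunctions.weilMellin g (1 / 2 + (Λ n : ℂ) * Complex.I)‖ ^ 2 ≤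
            B * ∫ u, ‖g u‖ ^ 2) →
    ∀ (H δ C w : ℝ) (m : ℕ) (γ₀ : Fin m → ℝ) (ν : MeasureTheory.Measure ℝ),
      1 ≤ H → 0 < δ → 0 < w → w < 2 * Real.pi / Real.log 3 →
      ν (Set.Ioo (-H) H) = 0 →
      (∀ T : ℝ, ν (Set.Icc T (T + 1)) ≤ ENNReal.ofReal (C * Real.log (2 + |T|))) →
      (∀ T : ℝ, H ≤ T →
        ENNReal.ofReal ((1 + δ) * (Real.log 3 / Real.pi) * w) ≤ ν (Set.Icc T (T + w))) →
      (∀ T : ℝ, T ≤ -H →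
        ENNReal.ofReal ((1 + δ) * (Real.log 3 / Real.pi) * w) ≤ ν (Set.Icc (T - w) T)) →
      ∃ (κ : Type) (γ : κ → ℝ),
        ∀ g : ℝ → ℂ, Literature.NumberTheory.LFunctions.IsWeilTest g →
          tsupport g ⊆ Set.Icc (-Real.log 3) (Real.log 3) →
          HasSum (fun i => Literature.NumberTheory.LFunctions.weilMellin g (1 / 2 + (γ i : ℂ) * Complex.I))
            ((∑ j, Literature.NumberTheory.LFunctions.weilMellin g (1 / 2 + (γ₀ j : ℂ) * Complex.I)) +
              ∫ t, Literature.NumberTheory.LFunctions.weilMellin g (1 / 2 + (t : ℂ) * Complex.I) ∂ν) := by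
  sorry

/-! ## Consistency: each named statement IS its registered stub (definitionally) -/

theorem bochnerWindowStatement_holds : BochnerWindowStatement := stub_bochnerWindow
theorem tailSlackStatement_holds : TailSlackStatement := stub_tailSlack
theorem bottomCrystalStatement_holds : BottomCrystalStatement := stub_bottomCrystal
theorem chirpStatement_holds : ChirpStatement := stub_chirp
theorem frameStatement_holds : FrameStatement := stub_frame
theorem crystalliseStatement_holds : CrystalliseStatement := stub_crystallise

/-- **c3's positivity half is now DERIVED** (reshape r2): the Bochner representer (`stub_bochnerWindow`) has
sub-Nyquist slack beyond some height (`stub_tailSlack`), and crystallising its bottom (`stub_bottomCrystal`)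
yields the anchor + gapped residual datum. -/
theorem residualExtendStatement_of (hB : BochnerWindowStatement) (hS : TailSlackStatement)
    (hBot : BottomCrystalStatement) : ResidualExtendStatement := by
  obtain ⟨μ, L₁, C, hL₁, htame, hrep⟩ := hB
  obtain ⟨H, δ, w, hH, hδ, hw, hw', hα, hα'⟩ := hS μ L₁ hL₁ hrep
  exact hBot μ L₁ C H δ w hL₁ htame hrep hH hδ hw hw' hα hα'

theorem residualExtendStatement_holds : ResidualExtendStatement :=
  residualExtendStatement_of stub_bochnerWindow stub_tailSlack stub_bottomCrystal

/-! ## Name-keyed aliases of the six statements (the hypotheses of the composition) -/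
namespace Registered

/-- Alias of `BochnerWindowStatement` keyed by the registered stub name. -/
abbrev stub_bochnerWindow : Prop := BochnerWindowStatement
/-- Alias of `TailSlackStatement` keyed by the registered stub name. -/
abbrev stub_tailSlack : Prop := TailSlackStatement
/-- Alias of `BottomCrystalStatement` keyed by the registered stub name. -/
abbrev stub_bottomCrystal : Prop := BottomCrystalStatement
/-- Alias of `ChirpStatement` keyed by the registered stub name. -/
abbrev stub_chirp : Prop := ChirpStatement
/-- Alias of `FrameStatement` keyed by the registered stub name. -/
abbrev stub_frame : Prop := FrameStatement
/-- Alias of `CrystalliseStatement` keyed by the registered stub name. -/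
abbrev stub_crystallise : Prop := CrystalliseStatement

end Registered

/-! ## The kernel-checked composition: the six stubs imply the crux, by name -/

/-- **The line concludes the crux BY NAME** (pure logic; no `sorry`): take the positive tame representer `μ` of
`W` on a window `L₁ > log 3` (`stub_bochnerWindow`), its sub-Nyquist slack beyond some height (`stub_tailSlack`),
trade its bottom for a finite real unit anchor `γ₀` plus a gapped positive tame slack measure `ν`
(`stub_bottomCrystal`), crystallise `Σ_j δ_{γ₀ⱼ} + ν` into a real unit-atomic family with the same window transform
(`stub_crystallise`, fed `stub_chirp` and `stub_frame`), and rewrite the target by the realisation identity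
`W(g) = Σ_j ĝ(γ₀ⱼ) + ∫ ĝ dν`. Witness: `ι = κ`, `γ` = the crystallised family. -/
theorem WindowTracePrime2_of (hB : Registered.stub_bochnerWindow) (hS : Registered.stub_tailSlack)
    (hBot : Registered.stub_bottomCrystal) (hC : Registered.stub_chirp) (hF : Registered.stub_frame)
    (hX : Registered.stub_crystallise) :
    Summit.RiemannHypothesis.RiemannHypothesis.Theses.SpectralTrace.WindowTracePrime2 := by
  obtain ⟨H, δ, C, w, m, γ₀, ν, hH, hδ, hw, hw', hsupp, hβ, hα, hα', hW⟩ :=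
    residualExtendStatement_of hB hS hBot
  obtain ⟨κ, γ, hγ⟩ := hX hC hF H δ C w m γ₀ ν hH hδ hw hw' hsupp hβ hα hα'
  refine ⟨κ, γ, fun g hg hs => ?_⟩
  rw [hW g hg hs]
  exact hγ g hg hs

/-- Wiring check: the registered stubs feed `WindowTracePrime2_of` as stated (an `example`, so that no
sorry-tainted DECLARATION of this file has the crux as its type). -/
example : Summit.RiemannHypothesis.RiemannHypothesis.Theses.SpectralTrace.WindowTracePrime2 :=
  WindowTracePrime2_of stub_bochnerWindow stub_tailSlack stub_bottomCrystal stub_chirp stub_frame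
    stub_crystallise

end Summit.RiemannHypothesis.RiemannHypothesis.Cruxes.WindowTracePrime2.AnchorFloat

end
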